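import Summits.Ventures.YMGap.FlowData.PolyakovHaarChain
import Summits.Ventures.YMGap.FlowData.TubeGaugeInvariance
import Summits.Ventures.YMGap.FlowData.TubeTransferPositivity
import Literature.Analysis.OperatorTheory.SlabFibreContraction
import HarnessLib

/-!
# Venture YMGap, track Y3 FLOW-DATA — the temporal-link integral of the slice kernel against a GAUGE-INVARIANT
# function, and its value on a POLYAKOV LINE (theorems only)

HONEST FRAMING: venture file of the cell `pub-ymgap` (QuantumFields programme), track Y3; companion THEOREMS for
`FlowData/TubeTransferOperator.lean` preparing `FlowData/TubeFluxNonAnnihilation.lean`.  Finite-dimensional Haar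
integrals on a finite spatial torus; no number, no row, nothing about limits or a mass gap.

For the generic slice kernel `K(a,b) = e^{J mag(a)/2} (∫ e^{J elec(a,E,b)} dE) e^{J mag(b)/2}` on `(ℤ/L)^k`:

* `integral_exp_elecSum_mul_eq_one` — for a GAUGE-INVARIANT `F`, the temporal links can be gauged away inside the
  `b`-integral: `∫ e^{J elec(a,E,b)} F(b) db = ∫ e^{J elec(a,1,b)} F(b) db` (`b ↦ b^E` preserves the slice measure,
  `elecSum_gaugeTransform_right`), hence `integral_integral_exp_elecSum_mul`:
  `∫ (∫ e^{J elec(a,E,b)} dE) F(b) db = ∫ (∏_e w(c_e)) F(c·a) dc` with the one-link Wilson weight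
  `w(g) = e^{J Re tr ρ(g)}` — the transfer operator acts on gauge-invariant functions as the link-wise convolution
  with `w` (Creutz; Montvay–Münster §3.2.6);
* `prod_ofFn_line_gaugeTransform`, `prod_ofFn_line_fluxTwist` — the holonomy of the straight POLYAKOV LINE
  `t ↦ (t ê_μ, μ)`, `t = 0, …, L−1`, winding the `μ`-cycle once, is conjugated by a gauge transformation and picks
  up exactly one factor `z` under the centre twist `s` iff `s_μ = 1`;
* **`integral_prod_weight_mul_re_trace_line`** — by the window lemma of the tree (`slab_integral_pi_window_one`:
  the links off the line integrate out) and the Haar chain (`integral_prod_mul_re_trace_chain`):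
  `∫ (∏_e w(c_e)) Re tr(A ρ(∏ₜ c_{ℓ(t)} a_t) B) dc = c₀^{N−m} λ^m Re tr(A ρ(∏ₜ a_t) B)` for any injective
  `ℓ : Fin m → links`, `c₀ = ∫ w`, `N` = number of links, `λ` the Schur scalar of `w`.

References: M. Creutz, *Quarks, gluons and lattices* (1983) Ch. 9; I. Montvay, G. Münster (1994) §3.2.6
[cite: MontvayMunster1994, §3.2.6]; G. 't Hooft, Nucl. Phys. B 153 (1979) 141 [cite: tHooft1979Flux].
-/

noncomputable section

open scoped BigOperators
open MeasureTheory Filter Function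
open Literature.MathematicalPhysics.QuantumFieldTheory Literature.Analysis.OperatorTheory

namespace Summit.Ventures.YMGap.FlowData

/-! ### Algebra of the straight Polyakov line `t ↦ (t ê_μ, μ)` -/

section LineAlgebra

variable {G : Type*} [Group G] {k L : ℕ} [NeZero L]

/-- Telescoping: `∏ₜ (gₜ fₜ g_{t+1}⁻¹) = g₀ (∏ₜ fₜ) g_m⁻¹` (ordered products). [folklore] -/
theorem prod_ofFn_telescope : ∀ (m : ℕ) (g f : ℕ → G),
    (List.ofFn fun t : Fin m => g t * f t * (g (t + 1))⁻¹).prod = g 0 * (List.ofFn fun t : Fin m => f t).prod * (g m)⁻¹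
  | 0, g, f => by simp
  | m + 1, g, f => by
    rw [List.ofFn_succ, List.prod_cons, List.ofFn_succ, List.prod_cons]
    have h := prod_ofFn_telescope m (fun t => g (t + 1)) (fun t => f (t + 1))
    simp only [Fin.val_zero, Fin.val_succ, zero_add] at h ⊢
    rw [h]
    group

omit [NeZero L] in
/-- The shifted base point of the `t`-th line link is the base point of the `(t+1)`-st. [folklore] -/
theorem lineSite_shift (μ : Fin k) (t : ℕ) :
    Site.shift (Pi.single μ ((t : ℕ) : ZMod L) : Site k L) μ = Pi.single μ (((t + 1 : ℕ) : ℕ) : ZMod L) := by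
  rw [Site.shift, ← Pi.single_add, Nat.cast_add, Nat.cast_one]

omit [NeZero L] in
/-- **A gauge transformation conjugates the line holonomy**: `∏ₜ (a^γ)(t ê_μ, μ) = γ(0) (∏ₜ a(t ê_μ, μ)) γ(0)⁻¹`
(the line closes up: `L ê_μ = 0`). [folklore] -/
theorem prod_ofFn_line_gaugeTransform (μ : Fin k) (γ : Site k L → G) (a : GaugeConfig k L G) :
    (List.ofFn fun t : Fin L => gaugeTransform γ a (Pi.single μ ((t : ℕ) : ZMod L), μ)).prod =
      γ 0 * (List.ofFn fun t : Fin L => a (Pi.single μ ((t : ℕ) : ZMod L), μ)).prod * (γ 0)⁻¹ := by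
  have h := prod_ofFn_telescope L (fun t => γ (Pi.single μ ((t : ℕ) : ZMod L)))
    (fun t => a (Pi.single μ ((t : ℕ) : ZMod L), μ))
  simp only [gaugeTransform, lineSite_shift]
  rw [h]
  simp only [Nat.cast_zero, Pi.single_zero, ZMod.natCast_self]

omit [NeZero L] in
/-- On the line, the twist prefactor is `z` exactly on the link `t = 0` of a twisted direction. [folklore] -/
theorem fluxTwistPrefactor_line (z : G) (s : Fin k → ZMod 2) (μ : Fin k) (t : Fin L) :
    fluxTwistPrefactor (L := L) z s (Pi.single μ ((t : ℕ) : ZMod L), μ) = if s μ = 1 ∧ (t : ℕ) = 0 then z else 1 := by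
  unfold fluxTwistPrefactor
  simp only [Pi.single_eq_same]
  have h : (((t : ℕ) : ZMod L) = 0) ↔ (t : ℕ) = 0 := by
    rw [ZMod.natCast_eq_zero_iff]
    exact ⟨fun hd => Nat.eq_zero_of_dvd_of_lt hd t.2, fun h0 => by rw [h0]; exact dvd_zero _⟩
  simp only [h]

/-- **The centre twist multiplies the line holonomy by one factor `z`** iff the line's direction is twisted:
`∏ₜ (twist a)(t ê_μ, μ) = z^{[s_μ = 1]} ∏ₜ a(t ê_μ, μ)`. [cite: tHooft1979Flux] -/
theorem prod_ofFn_line_fluxTwist (z : G) (s : Fin k → ZMod 2) (μ : Fin k) (a : GaugeConfig k L G) :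
    (List.ofFn fun t : Fin L => fluxTwist z s a (Pi.single μ ((t : ℕ) : ZMod L), μ)).prod =
      (if s μ = 1 then z else 1) * (List.ofFn fun t : Fin L => a (Pi.single μ ((t : ℕ) : ZMod L), μ)).prod := by
  obtain ⟨L', hL'⟩ := Nat.exists_eq_succ_of_ne_zero (NeZero.ne L)
  subst hL'
  simp only [fluxTwist_apply, fluxTwistPrefactor_line]
  rw [List.ofFn_succ, List.prod_cons, List.ofFn_succ, List.prod_cons]
  have htail : (fun i : Fin L' =>
      (if s μ = 1 ∧ ((i.succ : Fin (L' + 1)) : ℕ) = 0 then z else 1) *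
        a (Pi.single μ (((i.succ : Fin (L' + 1)) : ℕ) : ZMod (L' + 1)), μ)) =
      fun i : Fin L' => a (Pi.single μ (((i.succ : Fin (L' + 1)) : ℕ) : ZMod (L' + 1)), μ) := by
    funext i
    simp only [Fin.val_succ, Nat.add_eq_zero_iff, one_ne_zero, and_false, if_false, one_mul]
  rw [htail]
  simp only [Fin.val_zero, and_true, mul_assoc]

variable [TopologicalSpace G] [IsTopologicalGroup G]

/-- The line holonomy is a continuous function of the slice. [folklore] -/
theorem continuous_prod_ofFn_apply {ι : Type*} : ∀ (m : ℕ) (ℓ : Fin m → ι),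
    Continuous fun a : ι → G => (List.ofFn fun t : Fin m => a (ℓ t)).prod
  | 0, ℓ => by simp only [List.ofFn_zero, List.prod_nil]; exact continuous_const
  | m + 1, ℓ => by
    simp only [List.ofFn_succ, List.prod_cons]
    exact (continuous_apply _).mul (continuous_prod_ofFn_apply m fun t => ℓ t.succ)

end LineAlgebra

/-! ### Gauging away the temporal links against a gauge-invariant function -/

section Substitution

variable {G : Type*} [Group G] [TopologicalSpace G] [IsTopologicalGroup G] [CompactSpace G]
  [MeasurableSpace G] [BorelSpace G] [SecondCountableTopology G] {n : ℕ} (ρ : G →* Matrix (Fin n) (Fin n) ℂ)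
  (J : ℝ) {k L : ℕ} [NeZero L]

/-- **Gauging away the temporal links**: for a continuous gauge-invariant `F` and any temporal links `E`,
`∫ e^{J elec(a,E,b)} F(b) db = ∫ e^{J elec(a,1,b)} F(b) db` (substitute `b ↦ b^E`). [cite: MontvayMunster1994, §3.2.6] -/
theorem integral_exp_elecSum_mul_eq_one (hρ : Continuous ρ) {F : GaugeConfig k L G → ℝ} (hF : Continuous F)
    (hFg : ∀ (γ : Site k L → G) (b : GaugeConfig k L G), F (gaugeTransform γ b) = F b) (a : GaugeConfig k L G)
    (E : Site k L → G) :
    ∫ b, Real.exp (J * elecSum (d := k) (L := L) ρ a E b) * F b ∂(sliceMeasure G k L) =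
      ∫ b, Real.exp (J * elecSum (d := k) (L := L) ρ a 1 b) * F b ∂(sliceMeasure G k L) := by
  have hmp : MeasurePreserving (gaugeTransform E : GaugeConfig k L G → GaugeConfig k L G)
      (sliceMeasure G k L) (sliceMeasure G k L) := WilsonGauge.measurePreserving_gaugeTransform E
  set g : GaugeConfig k L G → ℝ := fun b => Real.exp (J * elecSum (d := k) (L := L) ρ a 1 b) * F b with hg
  have hgc : Continuous g := by
    have he : Continuous fun b : GaugeConfig k L G => elecSum (d := k) (L := L) ρ a 1 b :=
      Continuous.comp (g := fun q : GaugeConfig k L G × (Site k L → G) × GaugeConfig k L G =>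
          elecSum (d := k) (L := L) ρ q.1 q.2.1 q.2.2) (f := fun b => (a, (1 : Site k L → G), b))
        (continuous_elecSum_triple ρ hρ) (continuous_const.prodMk (continuous_const.prodMk continuous_id))
    exact (Real.continuous_exp.comp (continuous_const.mul he)).mul hF
  have h1 : (fun b => Real.exp (J * elecSum (d := k) (L := L) ρ a E b) * F b) = g ∘ gaugeTransform E := by
    funext b
    simp only [hg, comp_apply, elecSum_gaugeTransform_right, one_mul, hFg]
  rw [h1]
  have hg' : AEStronglyMeasurable g (Measure.map (gaugeTransform E) (sliceMeasure G k L)) := by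
    rw [hmp.map_eq]; exact hgc.aestronglyMeasurable
  have h2 := integral_map hmp.measurable.aemeasurable hg'
  rw [hmp.map_eq] at h2
  exact h2.symm

omit [TopologicalSpace G] [IsTopologicalGroup G] [CompactSpace G] [MeasurableSpace G] [BorelSpace G]
  [SecondCountableTopology G] in
/-- The un-averaged temporal weight at `E = 1` is the product of the one-link Wilson weights:
`e^{J elec(a,1,b)} = ∏_e e^{J Re tr ρ(b_e a_e⁻¹)}`. [folklore] -/
theorem exp_elecSum_one_eq_prod (a b : GaugeConfig k L G) :
    Real.exp (J * elecSum (d := k) (L := L) ρ a 1 b) =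
      ∏ e : Edge k L, Real.exp (J * (ρ (b e * (a e)⁻¹)).trace.re) := by
  unfold elecSum
  simp only [Pi.one_apply, inv_one, one_mul, mul_one, Finset.mul_sum, Real.exp_sum]
  rw [← Finset.prod_product', ← Finset.univ_product_univ]

omit [SecondCountableTopology G] in
/-- **Shifting the later slice by the earlier one**: `∫ (∏_e w(b_e a_e⁻¹)) F(b) db = ∫ (∏_e w(c_e)) F(c·a) dc`
(right translation `c ↦ c·a` link by link preserves the slice measure). [folklore] -/
theorem integral_prod_weight_shift (w : G → ℝ) (F : GaugeConfig k L G → ℝ) (a : GaugeConfig k L G) :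
    ∫ b, (∏ e : Edge k L, w (b e * (a e)⁻¹)) * F b ∂(sliceMeasure G k L) =
      ∫ c, (∏ e : Edge k L, w (c e)) * F (c * a) ∂(sliceMeasure G k L) := by
  have hmp : MeasurePreserving (fun c : GaugeConfig k L G => fun e => c e * a e) (sliceMeasure G k L)
      (sliceMeasure G k L) :=
    measurePreserving_pi (f := fun (e : Edge k L) (x : G) => x * a e) (fun _ : Edge k L => haarProbability G)
      (fun _ : Edge k L => haarProbability G) fun e => measurePreserving_mul_right (haarProbability G) (a e)
  have hemb : MeasurableEmbedding (fun c : GaugeConfig k L G => fun e => c e * a e) :=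
    (MeasurableEquiv.piCongrRight fun e : Edge k L => MeasurableEquiv.mulRight (a e)).measurableEmbedding
  rw [← hmp.integral_comp hemb]
  refine integral_congr_ae (Eventually.of_forall fun c => ?_)
  simp only [mul_inv_cancel_right]
  rfl

/-- **The temporal-link integral against a gauge-invariant function is a link-wise convolution**:
`∫ (∫ e^{J elec(a,E,b)} dE) F(b) db = ∫ (∏_e e^{J Re tr ρ(c_e)}) F(c·a) dc` for continuous gauge-invariant `F`.
[cite: MontvayMunster1994, §3.2.6] -/
theorem integral_integral_exp_elecSum_mul (hρ : Continuous ρ) {F : GaugeConfig k L G → ℝ} (hF : Continuous F)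
    (hFg : ∀ (γ : Site k L → G) (b : GaugeConfig k L G), F (gaugeTransform γ b) = F b) (a : GaugeConfig k L G) :
    ∫ b, (∫ E, Real.exp (J * elecSum (d := k) (L := L) ρ a E b) ∂(Measure.pi fun _ : Site k L => haarProbability G)) *
        F b ∂(sliceMeasure G k L) =
      ∫ c, (∏ e : Edge k L, Real.exp (J * (ρ (c e)).trace.re)) * F (c * a) ∂(sliceMeasure G k L) := by
  -- swap the `b` and `E` integrals
  have hc : Continuous fun p : GaugeConfig k L G × (Site k L → G) =>
      Real.exp (J * elecSum (d := k) (L := L) ρ a p.2 p.1) * F p.1 := by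
    have he : Continuous fun p : GaugeConfig k L G × (Site k L → G) => elecSum (d := k) (L := L) ρ a p.2 p.1 :=
      Continuous.comp (g := fun q : GaugeConfig k L G × (Site k L → G) × GaugeConfig k L G =>
          elecSum (d := k) (L := L) ρ q.1 q.2.1 q.2.2)
        (f := fun p : GaugeConfig k L G × (Site k L → G) => (a, p.2, p.1))
        (continuous_elecSum_triple ρ hρ) (continuous_const.prodMk (continuous_snd.prodMk continuous_fst))
    exact (Real.continuous_exp.comp (continuous_const.mul he)).mul (hF.comp continuous_fst)
  have hint : Integrable (uncurry fun (b : GaugeConfig k L G) (E : Site k L → G) =>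
      Real.exp (J * elecSum (d := k) (L := L) ρ a E b) * F b)
      ((sliceMeasure G k L).prod (Measure.pi fun _ : Site k L => haarProbability G)) :=
    hc.integrable_of_hasCompactSupport (HasCompactSupport.of_compactSpace _)
  simp_rw [← integral_mul_const]
  rw [integral_integral_swap hint]
  have h1 : ∀ E : Site k L → G, ∫ b, Real.exp (J * elecSum (d := k) (L := L) ρ a E b) * F b ∂(sliceMeasure G k L) =
      ∫ b, (∏ e : Edge k L, Real.exp (J * (ρ (b e * (a e)⁻¹)).trace.re)) * F b ∂(sliceMeasure G k L) := by
    intro E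
    rw [integral_exp_elecSum_mul_eq_one ρ J hρ hF hFg a E]
    simp_rw [exp_elecSum_one_eq_prod ρ J a]
  simp_rw [h1]
  rw [integral_const, probReal_univ, one_smul]
  exact integral_prod_weight_shift (fun g => Real.exp (J * (ρ g).trace.re)) F a

end Substitution

/-! ### The weighted slice integral of a Polyakov-line trace: window lemma and Haar chain -/

section Line

variable {G : Type*} [Group G] [TopologicalSpace G] [IsTopologicalGroup G] [CompactSpace G]
  [MeasurableSpace G] [BorelSpace G] [SecondCountableTopology G] {n : ℕ} (ρ : G →* Matrix (Fin n) (Fin n) ℂ)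
  {k L : ℕ} [NeZero L]

/-- **Links off the line integrate out, links on the line form a Haar chain**: for an injective family of links
`ℓ : Fin m → links`, a continuous weight `w` with Schur scalar `λ` (`∫ w ρ_{ij} = λ δ_{ij}`) and `c₀ = ∫ w`,
`∫ (∏_e w(c_e)) Re tr(A ρ(∏ₜ c_{ℓ t} aₜ) B) dc = c₀^{N − m} λ^m Re tr(A ρ(∏ₜ aₜ) B)`, `N` the number of links.
[folklore] -/
theorem integral_prod_weight_mul_re_trace_line {w : G → ℝ} (hw : Continuous w) (hρ : Continuous ρ) {lam : ℝ}
    (hM : ∀ i j, ∫ c, (w c : ℂ) * ρ c i j ∂haarProbability G = if i = j then (lam : ℂ) else 0) {m : ℕ}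
    (ℓ : Fin m → Edge k L) (hℓ : Injective ℓ) (a : Fin m → G) (A B : Matrix (Fin n) (Fin n) ℂ) :
    ∫ c, (∏ e : Edge k L, w (c e)) * (A * ρ ((List.ofFn fun t => c (ℓ t) * a t).prod) * B).trace.re
        ∂(sliceMeasure G k L) =
      (∫ g, w g ∂haarProbability G) ^ (Fintype.card (Edge k L) - m) * lam ^ m *
        (A * ρ ((List.ofFn a).prod) * B).trace.re := by
  classical
  set s : Set (Edge k L) := Set.range ℓ with hs
  set e : Fin m ⊕ ↥sᶜ ≃ Edge k L := (Equiv.sumCongr (Equiv.ofInjective ℓ hℓ) (Equiv.refl _)).trans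
    (Equiv.Set.sumCompl s) with he
  have he1 : ∀ t : Fin m, e (Sum.inl t) = ℓ t := fun t => by
    simp [he, Equiv.Set.sumCompl_apply_inl]
  set f : (Fin m → G) → ℝ := fun y => (A * ρ ((List.ofFn fun t => y t * a t).prod) * B).trace.re with hf
  have h1 : (fun c : GaugeConfig k L G =>
      (∏ e : Edge k L, w (c e)) * (A * ρ ((List.ofFn fun t => c (ℓ t) * a t).prod) * B).trace.re) =
      fun c => f (fun i => c (e (Sum.inl i))) * ∏ t : Edge k L, (fun _ : Edge k L => w) t (c t) := by
    funext c
    simp only [hf, he1, mul_comm]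
  rw [h1, slab_integral_pi_window_one (haarProbability G) e (fun _ : Edge k L => w) f]
  have h2 : ∫ y : Fin m → G, f y * ∏ i, (fun _ : Edge k L => w) (e (Sum.inl i)) (y i)
      ∂(Measure.pi fun _ => haarProbability G) = lam ^ m * (A * ρ ((List.ofFn a).prod) * B).trace.re := by
    simp only [hf]
    simp_rw [mul_comm (( _ : Matrix (Fin n) (Fin n) ℂ).trace.re) (∏ i : Fin m, w _)]
    exact integral_prod_mul_re_trace_chain ρ hw hρ hM m a A B
  rw [h2, Finset.prod_const, Finset.card_univ]
  have hcard : Fintype.card ↥sᶜ = Fintype.card (Edge k L) - m := by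
    rw [Fintype.card_compl_set, Set.card_range_of_injective hℓ, Fintype.card_fin]
  rw [hcard]
  ring

end Line

end Summit.Ventures.YMGap.FlowData
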